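import Mathlib
import HarnessLib
import Summits.HubbardSuperconductivity.HubbardSuperconductivity.Theorems.BalabanIRBirGappedPhaseReductionFockCoercivity
import Summits.HubbardSuperconductivity.HubbardSuperconductivity.Theorems.BalabanIRBirBdGPhaseCoercivityLyapunovFinal

/-!
# BalabanIR reduction `BirGappedPhaseReductionR` (stmt-14846): the fermion-side large-field bound is now UNCONDITIONAL

Support file (`--supports stmt-HubbardSuperconductivity-14846`; prover seat 2, session 11).

Crux 3 `BirBdGPhaseCoercivity` (stmt-2081) is CLOSED
(`Theorems.BirBdG.birBdGPhaseCoercivity_proof`, module `…BirBdGPhaseCoercivityLyapunovFinal`, all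
`μ ∈ (-4,4)`, `Δ₁, Δ₂ ≠ 0`, constant `c₀ = mΔ₁²/(2E_max²)`, `L₀ = 3`), and the typed Fock/Hölder
dictionary `fockCoercivity_of_birBdGPhaseCoercivity` (module `…GappedPhaseReductionFockCoercivity`,
session 6) consumed exactly its body as a hypothesis.  Composing the two gives, with NO hypothesis
left, the three fermion-side inputs that the reduction `BirGappedPhaseReductionR` (crux 4R, step
(2)(C) of its informal; crux 3 ROLE ¶) needs from the `d+id` Bogoliubov–de Gennes reference on the
Fock space of `FermionTorus 2 L` (transport along `equivTorusSite`, gap function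
`Δ_θ = -½ conj D(θ)`):

* (i)  PHASE RIGIDITY OF THE FOCK GROUND ENERGY: `E₀(H_F θ) - E₀(H_F 0) ≥ (c₀/2) S(θ)`,
  `S(θ) = Σ_x Σ_{y∼x} (1 - cos(θ_x - θ_y))`;
* (ii) THERMAL SLICE BOUND: `Re Z_β(θ) ≤ 4^{L²} e^{-βc₀S(θ)/2} Re Z_β(0)` for all `β ≥ 0`;
* (iii) SPACE-TIME WEIGHT BOUND (the "small factor per large-field point" of the multiscale engine,
  on the fermion side): for `M = 2^{k+1}` slices of width `a ≥ 0` and any space-time phase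
  configuration `Θ`, `‖Tr Π_i e^{-a H_F(Θ_i)}‖ ≤ 4^{L²} e^{-(a c₀/2) Σ_i S(Θ_i)} Re Z_{Ma}(0)`.

Nothing here is new mathematics; it records that the coercivity dictionary of the route is now a
theorem end-to-end (Hölder `…TraceHolder`, BdG-with-bond-data = free Fermi gas
`Literature…BdGBondHamiltonianParticleHole/FreeEnergyBounds`, `…FermionWeight`,
`…FockCoercivity`, crux 3), so that a line for 4R may cite (iii) instead of carrying `h3`.
-/

noncomputable section

namespace Summit.HubbardSuperconductivity.HubbardSuperconductivity.Theorems

open scoped BigOperators Matrix ComplexConjugate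
open Literature.MathematicalPhysics.QuantumLattice Literature.Probability.LatticeModels

/-- **Unconditional Fock-space phase coercivity of the `d+id` BdG reference** (crux 3 PROVED ∘ the
typed Fock/Hölder dictionary): for every `μ ∈ (-4,4)`, `Δ₁ ≠ 0`, `Δ₂ ≠ 0` there are `c₀ > 0`, `L₀`
with, for all `L ≥ L₀` on `FermionTorus 2 L`: (i) ground-energy rigidity
`(c₀/2) S(θ) ≤ E₀(H_F θ) - E₀(H_F 0)`, (ii) `Re Z_β(θ) ≤ 4^{L²} e^{-βc₀S(θ)/2} Re Z_β(0)` (`β ≥ 0`),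
(iii) `‖Tr Π_{i<2^{k+1}} e^{-aH_F(Θ_i)}‖ ≤ 4^{L²} e^{-(ac₀/2)Σ_i S(Θ_i)} Re Z_{2^{k+1}a}(0)` (`a ≥ 0`)
— the statement of `fockCoercivity_of_birBdGPhaseCoercivity` with its hypothesis discharged by
`BirBdG.birBdGPhaseCoercivity_proof`. [folklore] -/
theorem fockCoercivity_holds
    (μ Δ₁ Δ₂ : ℝ) (hμ : μ ∈ Set.Ioo (-4:ℝ) 4) (hΔ₁ : Δ₁ ≠ 0) (hΔ₂ : Δ₂ ≠ 0) :
    ∃ c₀ : ℝ, 0 < c₀ ∧ ∃ L₀ : ℕ, ∀ (L : ℕ) [NeZero L], L₀ ≤ L → letI : DecidableEq (Literature.MathematicalPhysics.QuantumLattice.FermionTorus 2 L) := LinearOrder.toDecidableEq; letI : DecidableEq (Literature.MathematicalPhysics.QuantumLattice.Orb (Literature.MathematicalPhysics.QuantumLattice.FermionTorus 2 L)) := LinearOrder.toDecidableEq; let nnx : Literature.Probability.LatticeModels.TorusSite 2 L → Literature.Probability.LatticeModels.TorusSite 2 L → Prop := fun x y => y = x + ![1, 0] ∨ y = x + ![-1,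 0]; let nny : Literature.Probability.LatticeModels.TorusSite 2 L → Literature.Probability.LatticeModels.TorusSite 2 L → Prop := fun x y => y = x + ![0, 1] ∨ y = x + ![0, -1]; let dg1 : Literature.Probability.LatticeModels.TorusSite 2 L → Literature.Probability.LatticeModels.TorusSite 2 L → Prop := fun x y => y = x + ![1, 1] ∨ y = x + ![-1, -1]; let dg2 : Literature.Probability.LatticeModels.TorusSite 2 L → Literature.Probability.LatticeModels.TorusSite 2 L → Prop := fun x y => y = x + ![1, -1] ∨ y = x + ![-1, 1]; let D : (Literature.Probability.LatticeModels.TorusSite 2 L → ℝ) → Matrix (Literature.Probability.LatticeModels.TorusSite 2 L) (Literature.Probability.LatticeModels.TorusSite 2 L) ℂ := fun θ x y => ((Δ₁ : ℂ) * ((if nnx x y then (1 : ℂ) else 0) - (if nny x y then (1 : ℂ) else 0)) + Complex.I * (Δ₂ : ℂ) * ((if dg1 x y then (1 : ℂ) else 0) - (if dg2 x y then (1 : ℂ) else 0))) * (Complex.exp (Complex.I * (θ x : ℂ)) + Complex.exp (Complex.I * (θ y : ℂ))) / 2; let e : Literature.MathematicalPhysics.QuantumLattice.FermionTorus 2 L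 ≃ Literature.Probability.LatticeModels.TorusSite 2 L := Literature.MathematicalPhysics.QuantumLattice.FermionTorus.equivTorusSite; let τ : Literature.MathematicalPhysics.QuantumLattice.FermionTorus 2 L → Literature.MathematicalPhysics.QuantumLattice.FermionTorus 2 L → ℂ := fun u v => -(if nnx (e u) (e v) ∨ nny (e u) (e v) then (1 : ℂ) else 0); let Δp : (Literature.Probability.LatticeModels.TorusSite 2 L → ℝ) → Literature.MathematicalPhysics.QuantumLattice.FermionTorus 2 L → Literature.MathematicalPhysics.QuantumLattice.FermionTorus 2 L → ℂ := fun θ u v => -(1 / 2 : ℂ) * star (D θ (e u) (e v)); let HF : (Literature.Probability.LatticeModels.TorusSite 2 L → ℝ) → Matrix (Finset (Literature.MathematicalPhysics.QuantumLattice.Orb (Literature.MathematicalPhysics.QuantumLattice.FermionTorus 2 L))) (Finset (Literature.MathematicalPhysics.QuantumLattice.Orb (Literature.MathematicalPhysics.QuantumLattice.FermionTorus 2 L))) ℂ := fun θ => Literature.MathematicalPhysics.QuantumLattice.bdgBondHamiltonian τ (Δp θ) μ; let S : (Literature.Probability.LatticeModels.TorusSite 2 L → ℝ) → ℝ := fun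 θ => ∑ x : Literature.Probability.LatticeModels.TorusSite 2 L, ∑ y : Literature.Probability.LatticeModels.TorusSite 2 L, (if nnx x y ∨ nny x y then (1 - Real.cos (θ x - θ y)) else 0); (∀ θ : Literature.Probability.LatticeModels.TorusSite 2 L → ℝ, c₀ / 2 * S θ ≤ (HF θ).groundEnergy - (HF (fun _ => 0)).groundEnergy) ∧ (∀ θ : Literature.Probability.LatticeModels.TorusSite 2 L → ℝ, ∀ β : ℝ, 0 ≤ β → (Matrix.partitionFn β (HF θ)).re ≤ 4 ^ (L ^ 2) * Real.exp (-(β * c₀ * S θ / 2)) * (Matrix.partitionFn β (HF (fun _ => 0))).re) ∧ (∀ (k : ℕ) (a : ℝ), 0 ≤ a → ∀ Θ : Fin (2 ^ (k + 1)) → Literature.Probability.LatticeModels.TorusSite 2 L → ℝ, ‖(List.ofFn fun i => NormedSpace.exp (-(a : ℂ) • HF (Θ i))).prod.trace‖ ≤ 4 ^ (L ^ 2) * Real.exp (-(a * c₀ / 2 * ∑ i, S (Θ i))) * (Matrix.partitionFn (((2 ^ (k + 1) : ℕ) : ℝ) * a) (HF (fun _ => 0))).re) :=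
  fockCoercivity_of_birBdGPhaseCoercivity BirBdG.birBdGPhaseCoercivity_proof μ Δ₁ Δ₂ hμ hΔ₁ hΔ₂

end Summit.HubbardSuperconductivity.HubbardSuperconductivity.Theorems

end
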